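import Summits.Ventures.QEC.Census.CNFEncodeSound
import HarnessLib

/-!
# Null-split fibre leaves (budget 1): semantic shapes and the «isolated null» lemma (CDX, engine seat qec-cdx-eng-1)

For a budget-1 fibre instance `SolvesAny n rows [u] w` with null coordinates `nulls`, qec-cdx-type-1's
`Fibre.Leaf.not_realised_of_nullSplit` consumes
* `h0 : ¬ ∃ a, SolvesAny n rows us w a ∧ ∀ c ∈ nulls, a c = false` and
* `hc : ∀ c ∈ nulls, ¬ ∃ a, SolvesAny n rows us w a ∧ a c = true ∧ ∀ c' ∈ nulls, c' ≠ c → a c' = false`.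
This file turns kernel leaf facts into these shapes: `h0_of_units` / `hc_of_units` from an appended-unit-clause refutation
(`cnfEncodeAny_append_unsat_imp`), and `hc_of_isolated` WITHOUT any solver for a null `c` that has an even row `r ∋ c` all of whose
other members are nulls (then `x_c = true` with the other nulls false makes `r` odd).  Pure logic over `lparity`.
-/

namespace Summit.Ventures.QEC.CircuitDistance

open Std.Sat Summit.Ventures.QEC.Census.CNFEncode

/-- The unit clauses «every null false». -/
def nullUnits (nulls : List ℕ) : List (CNF.Clause Nat) := nulls.map fun c => [(c, false)]

/-- The unit clauses «null `c` true, every other null false». -/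
def nullUnitsExcept (nulls : List ℕ) (c : ℕ) : List (CNF.Clause Nat) :=
  [(c, true)] :: (nulls.filter fun c' => c' ≠ c).map fun c' => [(c', false)]

/-- `h0` from the refuted leaf «base ++ nullUnits». -/
theorem h0_of_units {n : ℕ} {rows us : List (List ℕ)} {w : ℕ} (nulls : List ℕ)
    (h : ∀ a : ℕ → Bool, (∀ cl ∈ nullUnits nulls, CNF.Clause.eval a cl = true) → ¬ SolvesAny n rows us w a) :
    ¬ ∃ a, SolvesAny n rows us w a ∧ ∀ c ∈ nulls, a c = false := by
  rintro ⟨a, hsol, hnull⟩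
  refine h a ?_ hsol
  intro cl hcl
  obtain ⟨c, hc, rfl⟩ := List.mem_map.1 hcl
  simp [CNF.Clause.eval, hnull c hc]

/-- `hc c` from the refuted leaf «base ++ nullUnitsExcept c». -/
theorem hc_of_units {n : ℕ} {rows us : List (List ℕ)} {w : ℕ} (nulls : List ℕ) (c : ℕ)
    (h : ∀ a : ℕ → Bool, (∀ cl ∈ nullUnitsExcept nulls c, CNF.Clause.eval a cl = true) → ¬ SolvesAny n rows us w a) :
    ¬ ∃ a, SolvesAny n rows us w a ∧ a c = true ∧ ∀ c' ∈ nulls, c' ≠ c → a c' = false := by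
  rintro ⟨a, hsol, hac, hrest⟩
  refine h a ?_ hsol
  intro cl hcl
  simp only [nullUnitsExcept, List.mem_cons, List.mem_map, List.mem_filter] at hcl
  rcases hcl with rfl | ⟨c', ⟨hc'mem, hne⟩, rfl⟩
  · simp [CNF.Clause.eval, hac]
  · have hne' : c' ≠ c := by simpa using hne
    simp [CNF.Clause.eval, hrest c' hc'mem hne']

/-- Parity of a list all of whose entries except possibly `c` are false is `a c` if `c` occurs exactly once. -/
theorem lparity_of_single (a : ℕ → Bool) (c : ℕ) :
    ∀ r : List ℕ, r.Nodup → c ∈ r → (∀ x ∈ r, x ≠ c → a x = false) → lparity a r = a c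
  | [], _, hc, _ => by simp at hc
  | x :: xs, hnd, hc, hother => by
    rw [List.nodup_cons] at hnd
    simp only [lparity]
    by_cases hx : x = c
    · subst hx
      have : lparity a xs = false := by
        clear hc
        induction xs with
        | nil => rfl
        | cons y ys ih =>
          simp only [lparity]
          have hy : y ≠ x := fun e => hnd.1 (by simp [e])
          rw [hother y (by simp) hy]
          have hnd' : x ∉ ys ∧ ys.Nodup := ⟨fun h => hnd.1 (by simp [h]), (List.nodup_cons.1 hnd.2).2⟩
          rw [ih hnd' (fun z hz hzx => hother z (by
            rcases List.mem_cons.1 hz with h | h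
            · exact absurd h hzx
            · exact List.mem_cons_of_mem _ (List.mem_cons_of_mem _ h)) hzx)]
          simp
      rw [this]; simp
    · have hcx : c ∈ xs := by simpa [Ne.symm hx] using hc
      rw [hother x (by simp) hx, lparity_of_single a c xs hnd.2 hcx (fun z hz hzc => hother z (by simp [hz]) hzc)]
      simp

/-- The decidable «isolated null» condition: some row containing `c` has all other members among the nulls. -/
def isolatedNull (rows : List (List ℕ)) (nulls : List ℕ) (c : ℕ) : Bool :=
  rows.any fun r => decide r.Nodup && r.contains c && r.all fun x => x == c || nulls.contains x

/-- `hc c` WITHOUT a solver for an isolated null. -/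
theorem hc_of_isolated {n : ℕ} {rows us : List (List ℕ)} {w : ℕ} (nulls : List ℕ) (c : ℕ)
    (hiso : isolatedNull rows nulls c = true) :
    ¬ ∃ a, SolvesAny n rows us w a ∧ a c = true ∧ ∀ c' ∈ nulls, c' ≠ c → a c' = false := by
  rintro ⟨a, ⟨hrows, -, -⟩, hac, hrest⟩
  simp only [isolatedNull, List.any_eq_true, Bool.and_eq_true, decide_eq_true_eq, List.all_eq_true,
    Bool.or_eq_true, beq_iff_eq] at hiso
  obtain ⟨r, hr, ⟨⟨hnd, hcr⟩, hall⟩⟩ := hiso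
  have hcr' : c ∈ r := by simpa using hcr
  have hpar := lparity_of_single a c r hnd hcr' (fun x hx hxc => by
    rcases hall x hx with h | h
    · exact absurd h hxc
    · exact hrest x (by simpa using h) hxc)
  rw [hrows r hr, hac] at hpar
  exact Bool.false_ne_true hpar

/-- Assemble `hc` over all nulls from the usable ones (given individually) and the isolated ones (by `decide`). -/
theorem hc_all {n : ℕ} {rows us : List (List ℕ)} {w : ℕ} (nulls usable : List ℕ)
    (husable : ∀ c ∈ usable, ¬ ∃ a, SolvesAny n rows us w a ∧ a c = true ∧ ∀ c' ∈ nulls, c' ≠ c → a c' = false)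
    (hiso : (nulls.all fun c => usable.contains c || isolatedNull rows nulls c) = true) :
    ∀ c ∈ nulls, ¬ ∃ a, SolvesAny n rows us w a ∧ a c = true ∧ ∀ c' ∈ nulls, c' ≠ c → a c' = false := by
  intro c hc
  have := List.all_eq_true.1 hiso c hc
  rw [Bool.or_eq_true] at this
  rcases this with h | h
  · exact husable c (by simpa using h)
  · exact hc_of_isolated nulls c h

end Summit.Ventures.QEC.CircuitDistance
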